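import Literature.NumberTheory.EllipticCurves.Kato2004.LocPKernelRankOnePlumbing
import Literature.NumberTheory.EllipticCurves.SelmerLocalConditionGoodReductionAnyProofs
import Literature.NumberTheory.EllipticCurves.HasseWeilGoodReduction
import Literature.NumberTheory.EllipticCurves.CasselsTateLemma615
import Literature.NumberTheory.EllipticCurves.SelmerTorsionInclusion
import Literature.NumberTheory.EllipticCurves.HeegnerModuleIndex
import Summits.BirchSwinnertonDyer.BirchSwinnertonDyer.Theorems.KatoDescentPotSupersingularKatoFiniteLevelStrictCompactMap
import HarnessLib

set_option autoImplicit false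

/-!
# The level tower for `loc_p mod p^k` and for the local Kummer maps, and the uniform «Kummer at every place
# `≠ v_p`» multiple of the reductions of an integral class — plumbing for the EXISTENCE of Kummer logarithms
# (display (4) LOG-EX of `KatoDescentRankOneCountContraOfFacts.lean`; seat `bsd-cm-prr-ty1` g8, cell `bsd-cm`;
# theorems only: no definition, no named fact, no instance, no `sorry`)

Part 2 of the seat's kernel proof of display (4) LOG-EX of stub 3 `stub_rankOneCountReadingKato` of the
Kato–Perrin-Riou skeletons v4 (cruxes stmt-BirchSwinnertonDyer-19945, -19223; bsd-potss held input 27322).  Part 1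
= `KatoDescentLocPKummerLattice.lean` (lattice algebra of `E(ℚ_p)`); part 3 = `KatoDescentLocPKummerLogExistence.lean`
(assembly).  Here:

* §1 `ofTopSubgroup ∘ f_* = H¹(f) ∘ ofTopSubgroup` (functoriality bookkeeping between the tree's two `H¹`
  dialects: `mapH1AddHom` on `H¹(⊤, ·)` and `galoisCohomology.map` on `H¹(Γ_K, ·)`).
* §2 LOCAL KUMMER CLASSES UNDER A CHANGE OF LEVEL `F : E[n′] → E[n]`, `P ↦ c•P`, `n·c = n′` (the pattern of the
  tree's `map_torsionMulBy_localKummerClass`, Milne ADT I §6 proof of Prop. 6.9, freed from the syntactic shape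
  `n′ = c * n`): `H¹(F)(κ_{n′}(P)) = κ_n(P)` on `E(E)`-points (`map_localKummerMap_of_coe_eq`).
* §3 THE TOWER FOR `loc_p mod p^k`: for the transition map `E[p^{k+1}] → E[p^k]`, `P ↦ p•P`
  (`WeierstrassCurve.geomTorsionReduce`, promoted to a continuous intertwining map — `exists_transition`),
  `H¹(F|Γ_{ℚ_v})(locModPk (k+1) y) = locModPk k y` (tree `mapH1AddHom_reduceH1Pk_succ` + §1 + `res_map_one`).
* §4 Selmer local conditions and Selmer groups are invariant under the change of level `H¹(K,E[d]) → H¹(K,E[N])`,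
  `d ∣ N` (both are preimages under `H¹(K,E[·]) → H¹(K,E)`, tree `selmerLocalKer_eq_comap`, `selmerGroup_eq_comap_sha`).
* §5 THE UNIFORM MULTIPLE (cell bsd-cn100's local analysis for `locP_kernel_isTorsion_of_rankOne_holds`, minus
  the place `p`): for `x ∈ H¹(ℤ[1/p], T_pW)` there is ONE `T ≠ 0` such that for EVERY `k` the class
  `T • red_{p^k} x`, moved to level `((p^k : ℕ) : ℤ)`, satisfies the Kummer condition at every place `≠ v_p`, i.e.
  lies in `kummerOutside W (p^k) {v_p}` (= `H¹_{𝓛, ⊤ at v_p}(ℚ, W[p^k])` of cell b2b-bsdres's `X11b.Relaxation`).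

HONEST LABEL: unconditional TOOL theorems; no stub or item is closed; nothing is asserted on 19945 / 19223; BSD is
not proved for any curve.

References: [Kato2004Asterisque] §8.2 / Lemma 8.5 (pp. 180–184), §13.8 (p. 228), §14.9 (14.9.3) (p. 240);
[MilneADT2006] I Lemma 2.10, Prop. 3.8, §6 (proof of Prop. 6.9); [SilvermanAEC2009] VIII.§2, X.§4 (**);
[PerrinRiou1987BSMF] §0 (p. 401); [SerreGaloisCohomology1997] I §2.2–2.4.
-/

noncomputable section

open scoped Classical NumberField ContRepresentation

open CategoryTheory Field IsDedekindDomain NumberField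
open Literature.NumberTheory.GaloisRepresentations
open Literature.NumberTheory.EllipticCurves Literature.NumberTheory.EllipticCurves.Kato2004
open Literature.NumberTheory.EllipticCurves.Kato2004.EulerSystemValues
open WeierstrassCurve (geomPoints geomTorsion galH1Torsion selmerLocalKer selmerGroup torsionPoints
  toGeomPoints)

universe u

namespace Summit.BirchSwinnertonDyer.Rank1Residual.Additive.LocPKummer

/-! ## §1 `ofTopSubgroup` commutes with the change of coefficients -/

section OfTop

variable {K : Type u} [Field K] {M N : Type u} [AddCommGroup M] [TopologicalSpace M] [DiscreteTopology M]
  [AddCommGroup N] [TopologicalSpace N] [DiscreteTopology N]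
  {ρ : DiscreteGaloisModule K M} {ρ' : DiscreteGaloisModule K N}

/-- `ofTopSubgroup : H¹(⊤, M) → H¹(Γ_K, M)` on classes of continuous crossed homomorphisms of a discrete Galois
module (pull-back along `Γ_K ≅ ⊤`; the tree's `map_oneCocycleClass`). [folklore] -/
theorem ofTopSubgroup_hom_oneCocycleClass' (τ : DiscreteGaloisModule K M)
    (ψ : contOneCocycles (subgroupRep τ.toTopRep ⊤)) :
    (ofTopSubgroup τ.toTopRep 1).hom (oneCocycleClass _ ψ) =
      oneCocycleClass τ.toTopRep (contOneCocycles.pullback toTopSubgroupHom (X := subgroupRep τ.toTopRep ⊤)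
        (Y := τ.toTopRep) (TopRep.ofHom ⟨ContinuousLinearMap.id ℤ M, fun _ => rfl⟩) ψ) :=
  map_oneCocycleClass _ _ _ ψ

/-- **`ofTopSubgroup ∘ f_* = H¹(F) ∘ ofTopSubgroup`** for a continuous `Γ_K`-equivariant `F : M → N` with
underlying additive map `f` (both composites send `[φ]` to `[F ∘ φ ∘ (Γ_K ≅ ⊤)]`).
[cite: SerreGaloisCohomology1997, I §2.2–2.4] -/
theorem ofTopSubgroup_hom_mapH1AddHom (F : ρ.toContRepresentation →ⁱL ρ'.toContRepresentation)
    (f : M →+ N) (hfF : ∀ x, f x = F x) (hf : Continuous f)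
    (hρ : ∀ (g : (⊤ : Subgroup (absoluteGaloisGroup K))) (x : M),
      f ((subgroupRep ρ.toTopRep ⊤).ρ g x) = (subgroupRep ρ'.toTopRep ⊤).ρ g (f x))
    (c : continuousCohomology 1 (subgroupRep ρ.toTopRep ⊤)) :
    (ofTopSubgroup ρ'.toTopRep 1).hom
        (mapH1AddHom (subgroupRep ρ.toTopRep ⊤) (subgroupRep ρ'.toTopRep ⊤) f hf hρ c) =
      galoisCohomology.map F 1 ((ofTopSubgroup ρ.toTopRep 1).hom c) := by
  obtain ⟨φ, rfl⟩ := oneCocycleClass_surjective _ c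
  rw [mapH1AddHom_oneCocycleClass, ofTopSubgroup_hom_oneCocycleClass', ofTopSubgroup_hom_oneCocycleClass',
    galoisCohomology.map_one_oneCocycleClass]
  congr 1
  apply Subtype.ext
  ext g
  exact hfF _

end OfTop

/-! ## §2 Local Kummer classes under a change of level `F : E[n′] → E[n]`, `P ↦ c • P`, `n·c = n′` -/

section Level

variable {K : Type u} [Field K] (W : WeierstrassCurve K) {E : Type u} [Field E] [Algebra K E]
  [CharZero K] [W.IsElliptic] {n n' : ℤ} (hn : n ≠ 0) (hn' : n' ≠ 0) (c : ℤ)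
  (F : (W.torsionGaloisModule n').toContRepresentation →ⁱL (W.torsionGaloisModule n).toContRepresentation)
  (hF : ∀ P : geomTorsion W n', ((F P : geomTorsion W n) : geomPoints W) = c • (P : geomPoints W))

omit [CharZero K] [W.IsElliptic] in
/-- `c • T ∈ E(K̄_E)[n]` for `T ∈ E(K̄_E)[n′]` when `n·c = n′`. [folklore] -/
theorem zsmul_mem_torsionBy_localPoints_of_mul_eq (hcn : n * c = n') {T : localPoints W E}
    (hT : T ∈ AddSubgroup.torsionBy (localPoints W E) n') :
    c • T ∈ AddSubgroup.torsionBy (localPoints W E) n := by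
  change n • (c • T) = 0
  have hT' : n' • T = 0 := hT
  rw [smul_smul, hcn, hT']

include hF in
/-- Compatibility of the torsion comparison `θ` with `F`: `θ_n⁻¹(c • T) = F(θ_{n′}⁻¹ T)` for
`T ∈ E(K̄_E)[n′]` (the pattern of the tree's `torsionPointsEquiv_symm_zsmul`). [folklore] -/
theorem torsionPointsEquiv_symm_of_coe_eq (hcn : n * c = n')
    (T : AddSubgroup.torsionBy (localPoints W E) n') :
    (W.torsionPointsEquiv n (E := E) hn).symm
        ⟨c • (T : localPoints W E), zsmul_mem_torsionBy_localPoints_of_mul_eq W c hcn T.2⟩ =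
      F ((W.torsionPointsEquiv n' (E := E) hn').symm T) := by
  apply (W.torsionPointsEquiv n (E := E) hn).injective
  apply Subtype.ext
  rw [AddEquiv.apply_symm_apply, WeierstrassCurve.coe_torsionPointsEquiv_apply, hF, map_zsmul]
  change c • (T : localPoints W E) = c • pointsMap W E
    (((W.torsionPointsEquiv n' (E := E) hn').symm T : geomTorsion W n') : geomPoints W)
  rw [WeierstrassCurve.pointsMap_torsionPointsEquiv_symm]

include hF in
/-- **Local Kummer classes under `F`**: `H¹(F|Γ_E)(κ_{E,n′}(Q)) = κ_{E,n}(c • Q)` for `Q ∈ E(K̄_E)` with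
`n′ • Q ∈ E(E)` (the cocycle `σ ↦ θ⁻¹(σQ − Q)` is carried to `σ ↦ θ⁻¹(σ(cQ) − cQ)`).
[cite: MilneADT2006, Ch. I §6, proof of Prop. 6.9] [cite: SilvermanAEC2009, VIII.§2] -/
theorem map_localKummerClass_of_coe_eq (hcn : n * c = n') (Q : localPoints W E)
    (hQ : n' • Q ∈ MulAction.fixedPoints (absoluteGaloisGroup E) (localPoints W E))
    (hQ' : n • (c • Q) ∈ MulAction.fixedPoints (absoluteGaloisGroup E) (localPoints W E)) :
    galoisCohomology.map (F.restrictField E) 1 (W.localKummerClass n' hn' Q hQ) =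
      W.localKummerClass n hn (c • Q) hQ' := by
  unfold WeierstrassCurve.localKummerClass
  rw [galoisCohomology.map_one_oneCocycleClass]
  congr 1
  apply Subtype.ext
  ext σ : 1
  have h := (torsionPointsEquiv_symm_of_coe_eq W hn hn' c F hF hcn
    ⟨σ • Q - Q, WeierstrassCurve.smul_sub_mem_torsionBy_localPoints hQ σ⟩).symm
  refine h.trans ?_
  change (W.torsionPointsEquiv n (E := E) hn).symm _ =
    (W.torsionPointsEquiv n (E := E) hn).symm ⟨σ • (c • Q) - c • Q, _⟩
  congr 1
  apply Subtype.ext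
  change c • (σ • Q - Q) = σ • (c • Q) - c • Q
  rw [zsmul_sub, WeierstrassCurve.smul_zsmul_localPoints]

include hF in
/-- **The local Kummer MAPS under `F`: `H¹(F|Γ_E)(κ_{n′}(P)) = κ_n(P)` on `E`-rational points** (`κ_{n′}(P) =
κ_{E,n′}(R)` with `n′R = P`, and `n • (c • R) = n′ • R = P`). The case `n′ = p^{k+1}`, `n = p^k`, `c = p` is the
transition «`b_{v,1} ↦ b_v`» of the level tower. [cite: MilneADT2006, Ch. I §6, proof of Prop. 6.9] [cite: SilvermanAEC2009, X.§4 diagram (**)] -/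
theorem map_localKummerMap_of_coe_eq (hcn : n * c = n') (P : (W.baseChange E).toAffine.Point) :
    galoisCohomology.map (F.restrictField E) 1 (W.localKummerMap E hn' P) = W.localKummerMap E hn P := by
  have hR := W.zsmul_localZSMulRoot E hn' P
  have hfix := W.zsmul_mem_fixedPoints_of_eq E hR
  have hR' : n • (c • W.localZSMulRoot E hn' P) =
      W.baseChangeGeomPointsEquiv E (toGeomPoints (W.baseChange E) P) := by
    rw [smul_smul, hcn, hR]
  have hfix' := W.zsmul_mem_fixedPoints_of_eq E hR'
  rw [W.localKummerMap_eq_localKummerClass E hn' P _ hfix hR,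
    map_localKummerClass_of_coe_eq W hn hn' c F hF hcn _ hfix hfix',
    ← W.localKummerMap_eq_localKummerClass E hn P _ hfix' hR']

end Level

/-! ## §3 The transition map `E[p^{k+1}] → E[p^k]`, `P ↦ p • P`, and the tower for `loc_p mod p^k` -/

section Transition

variable {K : Type u} [Field K] (W : WeierstrassCurve K) (p k : ℕ)

/-- **The transition map `E[p^{k+1}] → E[p^k]`, `P ↦ p • P`, as a continuous `Γ_K`-intertwining map** of the
discrete Galois modules `torsionGaloisModule` (the tree's additive `WeierstrassCurve.geomTorsionReduce`, whose
equivariance is `transition_subgroupRep`; existence form, no new definition). [cite: PerrinRiou1987BSMF, §0 (p. 401)] -/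
theorem exists_transition :
    ∃ F : (W.torsionGaloisModule ((p : ℤ) ^ (k + 1))).toContRepresentation →ⁱL
        (W.torsionGaloisModule ((p : ℤ) ^ k)).toContRepresentation,
      ∀ P, F P = W.geomTorsionReduce p k P := by
  refine ⟨{ toContinuousLinearMap := ⟨(W.geomTorsionReduce p k).toIntLinearMap, continuous_of_discreteTopology⟩
            isIntertwining' := fun σ => ?_ }, fun P => rfl⟩
  ext P
  change (p : ℤ) • ((σ • P : geomTorsion W ((p : ℤ) ^ (k + 1))) : geomPoints W) =
    ((σ • W.geomTorsionReduce p k P : geomTorsion W ((p : ℤ) ^ k)) : geomPoints W)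
  rw [Literature.NumberTheory.EllipticCurves.AddSubgroup.torsionBy.coe_smul,
    Literature.NumberTheory.EllipticCurves.AddSubgroup.torsionBy.coe_smul, WeierstrassCurve.coe_geomTorsionReduce,
    WeierstrassCurve.smul_zsmul_geomPoints]

/-- `p^k · p = p^{k+1}` in `ℤ` (the level identity `n·c = n′` of §2 for the transition map). [folklore] -/
theorem intPow_mul_eq_pow_succ (p k : ℕ) : ((p : ℤ) ^ k) * (p : ℤ) = (p : ℤ) ^ (k + 1) := (pow_succ _ _).symm

end Transition

section Tower

variable (W : WeierstrassCurve ℚ) [W.IsElliptic] (p k : ℕ) [Fact p.Prime] [ContinuousSMul ℤ_[p] (W.tateModule p)]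

/-- **The tower for `loc_p mod p^k`**: for the transition map `F : W[p^{k+1}] → W[p^k]` (`P ↦ p • P`),
`H¹(F|Γ_{ℚ_v})(locModPk (k+1) y) = locModPk k y` (`v = primePlace p`): `red_{p^{k+1}} ↦ red_{p^k}` under `f_*`
(`mapH1AddHom_reduceH1Pk_succ`), `ofTopSubgroup` and `res` commute with the change of coefficients (§1,
`galoisCohomology.res_map_one`). [cite: Kato2004Asterisque, §13.8 (p. 228)] [cite: PerrinRiou1987BSMF, §0 (p. 401)] -/
theorem map_restrictField_locModPk_succ
    (F : (W.torsionGaloisModule ((p : ℤ) ^ (k + 1))).toContRepresentation →ⁱL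
      (W.torsionGaloisModule ((p : ℤ) ^ k)).toContRepresentation)
    (hF : ∀ P, F P = W.geomTorsionReduce p k P) (y : H1 (tateRep W p) ⊤) :
    galoisCohomology.map (F.restrictField ((primePlace p).adicCompletion ℚ)) 1 (locModPk W p (k + 1) y) =
      locModPk W p k y := by
  rw [locModPk_apply, locModPk_apply, ← galoisCohomology.res_map_one,
    ← ofTopSubgroup_hom_mapH1AddHom F (W.geomTorsionReduce p k) (fun P => (hF P).symm) continuous_of_discreteTopology
      (transition_subgroupRep W p k (W.geomTorsionReduce p k) (W.coe_geomTorsionReduce p k) ⊤),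
    mapH1AddHom_reduceH1Pk_succ W p k ⊤ (W.geomTorsionReduce p k) (W.coe_geomTorsionReduce p k)]

omit [ContinuousSMul ℤ_[p] (W.tateModule p)] in
/-- **The tower for the local Kummer maps at `v = primePlace p`**: `H¹(F|Γ_{ℚ_v})(κ_{p^{k+1}}(Q)) = κ_{p^k}(Q)` for
every `Q ∈ W(ℚ_v)` (§2 with `n′ = p^{k+1}`, `n = p^k`, `c = p`). [cite: MilneADT2006, Ch. I §6, proof of Prop. 6.9] -/
theorem map_restrictField_localKummerMap_succ
    (F : (W.torsionGaloisModule ((p : ℤ) ^ (k + 1))).toContRepresentation →ⁱL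
      (W.torsionGaloisModule ((p : ℤ) ^ k)).toContRepresentation)
    (hF : ∀ P, F P = W.geomTorsionReduce p k P)
    (Q : (W.baseChange ((primePlace p).adicCompletion ℚ)).toAffine.Point) :
    galoisCohomology.map (F.restrictField ((primePlace p).adicCompletion ℚ)) 1
        (W.localKummerMap ((primePlace p).adicCompletion ℚ)
          (pow_ne_zero (k + 1) (Int.natCast_ne_zero.mpr (Fact.out : p.Prime).ne_zero)) Q) =
      W.localKummerMap ((primePlace p).adicCompletion ℚ)
        (pow_ne_zero k (Int.natCast_ne_zero.mpr (Fact.out : p.Prime).ne_zero)) Q :=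
  map_localKummerMap_of_coe_eq W _ _ (p : ℤ) F (fun P => by rw [hF]; exact W.coe_geomTorsionReduce p k P)
    (intPow_mul_eq_pow_succ p k) Q

end Tower

/-! ## §4 Selmer local conditions and Selmer groups under the change of level `E[d] ↪ E[N]` -/

section SelmerLevel

variable {K : Type u} [Field K] (W : WeierstrassCurve K) {d N : ℤ} (h : d ∣ N)

/-- **The local Selmer condition is invariant under the change of level**: for a `K`-field `E`,
`ι_* c ∈ selmerLocalKer W E N ↔ c ∈ selmerLocalKer W E d` (both are the preimage of
`ker (H¹(K, E) → H¹(E, E))`, and `H¹(K,E[d]) → H¹(K,E[N]) → H¹(K,E)` is `H¹(K,E[d]) → H¹(K,E)`).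
[cite: SilvermanAEC2009, X.§4 diagram (**)] -/
theorem torsionH1OfDvd_mem_selmerLocalKer_iff (E : Type u) [Field E] [Algebra K E] (c : galH1Torsion W d) :
    WeierstrassCurve.torsionH1OfDvd W h c ∈ selmerLocalKer W E N ↔ c ∈ selmerLocalKer W E d := by
  rw [WeierstrassCurve.selmerLocalKer_eq_comap, WeierstrassCurve.selmerLocalKer_eq_comap, AddSubgroup.mem_comap,
    AddSubgroup.mem_comap, WeierstrassCurve.torsionH1ToH1_torsionH1OfDvd]

variable [NumberField K]

/-- **The Selmer group is invariant under the change of level**: `ι_* c ∈ Sel⁽ᴺ⁾(E/K) ↔ c ∈ Sel⁽ᵈ⁾(E/K)`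
(both are the preimage of `Ш(E/K)`). [cite: SilvermanAEC2009, X.§4] -/
theorem torsionH1OfDvd_mem_selmerGroup_iff (c : galH1Torsion W d) :
    WeierstrassCurve.torsionH1OfDvd W h c ∈ selmerGroup W N ↔ c ∈ selmerGroup W d := by
  rw [WeierstrassCurve.selmerGroup_eq_comap_sha, WeierstrassCurve.selmerGroup_eq_comap_sha, AddSubgroup.mem_comap,
    AddSubgroup.mem_comap, WeierstrassCurve.torsionH1ToH1_torsionH1OfDvd]

end SelmerLevel

/-! ## §5 The uniform «Kummer at every place `≠ v_p`» multiple of the reductions of an integral class -/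

section Uniform

variable (W : WeierstrassCurve ℚ) [W.IsElliptic] (p : ℕ) [Fact p.Prime] [ContinuousSMul ℤ_[p] (W.tateModule p)]

omit [Fact p.Prime] in
/-- `(p : ℤ)^k ∣ ((p^k : ℕ) : ℤ)` (the two level dialects of the tree: `Kato2004.reduceH1Pk` and
`X11b.Relaxation.kummerOutside`). [folklore] -/
theorem intPow_dvd_natCast_pow' (k : ℕ) : ((p : ℤ) ^ k) ∣ ((p ^ k : ℕ) : ℤ) :=
  ⟨1, by rw [Nat.cast_pow, mul_one]⟩

/-- **ONE `T ≠ 0` such that `T • red_{p^k} x` is Kummer at EVERY place `≠ v_p`, for EVERY `k`**, for an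
integral class `x ∈ H¹(ℤ[1/p], T_pW)` (read in `H¹(⊤, T_pW)`): `red_{p^k} x` is unramified away from `p`
(`ofTopSubgroup_mem_unramifiedKer_of_mem_integralH1`), hence Kummer at every GOOD `v ≠ v_p` (Milne I 3.8,
`unramifiedKer_le_selmerLocalKer_of_hasGoodReductionAt`), Kummer at the finitely many BAD `v ≠ v_p` after a multiple
UNIFORM in the level (`exists_uniform_nsmul_mem_selmerLocalKer_of_mem_unramifiedKer`, Milne I 2.10), and Kummer at
`∞` after multiplication by `2`; `T = 2·∏_{bad v} t_v`.  (Cell bsd-cn100's analysis for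
`locP_kernel_isTorsion_of_rankOne_holds`, without the condition at `p`.) [cite: MilneADT2006, Ch. I, Lemma 2.10 and Prop. 3.8]
[cite: Kato2004Asterisque, §8.2 and Lemma 8.5 (pp. 180–184)] -/
theorem exists_uniform_nsmul_mem_selmerLocalKer_away {x : H1 (tateRep W p) ⊤}
    (hx : x ∈ integralH1 (tateRep W p) p ⊤) :
    ∃ T : ℕ, T ≠ 0 ∧ ∀ k : ℕ,
      (∀ v : HeightOneSpectrum (𝓞 ℚ), v ≠ primePlace p →
        T • (ofTopSubgroup (W.torsionGaloisModule ((p : ℤ) ^ k)).toTopRep 1).hom (reduceH1Pk W p k ⊤ x) ∈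
          selmerLocalKer W (v.adicCompletion ℚ) ((p : ℤ) ^ k)) ∧
      ∀ w : InfinitePlace ℚ,
        T • (ofTopSubgroup (W.torsionGaloisModule ((p : ℤ) ^ k)).toTopRep 1).hom (reduceH1Pk W p k ⊤ x) ∈
          selmerLocalKer W w.Completion ((p : ℤ) ^ k) := by
  have hp : p.Prime := Fact.out
  -- the finitely many bad places and the uniform local exponents
  obtain ⟨S, hS⟩ : ∃ S : Finset (HeightOneSpectrum (𝓞 ℚ)), ∀ v, v ∉ S → W.HasGoodReductionAt v := by
    have h := WeierstrassCurve.eventually_hasGoodReductionAt W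
    rw [Filter.eventually_cofinite] at h
    exact ⟨h.toFinset, fun v hv => by_contra fun hbad => hv (h.mem_toFinset.mpr hbad)⟩
  choose t ht0 ht using fun v : HeightOneSpectrum (𝓞 ℚ) =>
    exists_uniform_nsmul_mem_selmerLocalKer_of_mem_unramifiedKer W v
  refine ⟨2 * ∏ v ∈ S, t v, Nat.mul_ne_zero two_ne_zero (Finset.prod_ne_zero_iff.mpr fun v _ => ht0 v),
    fun k => ⟨fun v hvp => ?_, fun w => ?_⟩⟩
  · set n : ℤ := (p : ℤ) ^ k with hn
    have hn0 : n ≠ 0 := pow_ne_zero k (Int.natCast_ne_zero.mpr hp.ne_zero)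
    set c : galH1Torsion W n :=
      (ofTopSubgroup (W.torsionGaloisModule n).toTopRep 1).hom (reduceH1Pk W p k ⊤ x) with hc
    have hunr : ∀ 𝔓 ∈ v.primesAbove, c ∈ unramifiedKer (geomTorsion W n) 𝔓 := fun 𝔓 h𝔓 =>
      ofTopSubgroup_mem_unramifiedKer_of_mem_integralH1 W p n (reduceH1Pk_mem_integralH1 W p k ⊤ hx)
        (Summit.BirchSwinnertonDyer.BirchSwinnertonDyer.Theorems.KatoFiniteLevelCount.primesEquiv_ne_of_ne_primePlace
          p hvp) h𝔓
    by_cases hvS : v ∈ S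
    · have h1 : t v • c ∈ selmerLocalKer W (v.adicCompletion ℚ) n := ht v n hn0 c hunr
      obtain ⟨q, hq⟩ : t v ∣ 2 * ∏ v ∈ S, t v := (Finset.dvd_prod_of_mem t hvS).trans (Dvd.intro_left 2 rfl)
      rw [hq, mul_comm, mul_nsmul']
      exact AddSubgroup.nsmul_mem _ h1 q
    · obtain ⟨𝔓, h𝔓⟩ := v.primesAbove_nonempty
      exact AddSubgroup.nsmul_mem _
        (W.unramifiedKer_le_selmerLocalKer_of_hasGoodReductionAt (hS v hvS) n h𝔓 (hunr 𝔓 h𝔓)) _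
  · rw [mul_comm, mul_nsmul']
    exact AddSubgroup.nsmul_mem _ (two_nsmul_mem_selmerLocalKer_infinitePlace W w _) _

/-- **The uniform multiple moved to the level `((p^k : ℕ) : ℤ)` lies in `kummerOutside W (p^k) {v_p}`** — the
group `H¹_{𝓛, ⊤ at v_p}(ℚ, W[p^k])` of classes satisfying the Kummer condition at every place other than
`v_p = primePlace p` (cell b2b-bsdres, `CasselsTateLemma615.kummerOutside`): §4 transports the local Selmer
conditions along `W[(p:ℤ)^k] ↪ W[((p^k:ℕ):ℤ)]`, and the Kummer condition at a place is the local Selmer condition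
(`comap_res_kummerLocalConditionAt`). [cite: MilneADT2006, Ch. I §6, (6.5) and Lemma 6.15] -/
theorem exists_uniform_nsmul_torsionH1OfDvd_mem_kummerOutside {x : H1 (tateRep W p) ⊤}
    (hx : x ∈ integralH1 (tateRep W p) p ⊤) :
    ∃ T : ℕ, T ≠ 0 ∧ ∀ k : ℕ,
      WeierstrassCurve.torsionH1OfDvd W (intPow_dvd_natCast_pow' p k)
          (T • (ofTopSubgroup (W.torsionGaloisModule ((p : ℤ) ^ k)).toTopRep 1).hom (reduceH1Pk W p k ⊤ x)) ∈
        kummerOutside W (p ^ k) {(Sum.inr (primePlace p) : Place ℚ)} := by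
  obtain ⟨T, hT0, hT⟩ := exists_uniform_nsmul_mem_selmerLocalKer_away W p hx
  refine ⟨T, hT0, fun k => ?_⟩
  obtain ⟨hfin, hinf⟩ := hT k
  refine (mem_kummerOutside_iff W (p ^ k) _ _).mpr fun v hv => ?_
  have hmem : WeierstrassCurve.torsionH1OfDvd W (intPow_dvd_natCast_pow' p k)
      (T • (ofTopSubgroup (W.torsionGaloisModule ((p : ℤ) ^ k)).toTopRep 1).hom (reduceH1Pk W p k ⊤ x)) ∈
      selmerLocalKer W (Place.Completion v) ((p ^ k : ℕ) : ℤ) := by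
    rw [torsionH1OfDvd_mem_selmerLocalKer_iff]
    rcases v with w | v
    · exact hinf w
    · have hvp : v ≠ primePlace p := fun h => hv (by rw [h, Finset.mem_singleton])
      exact hfin v hvp
  rw [← WeierstrassCurve.comap_res_kummerLocalConditionAt] at hmem
  exact hmem

end Uniform

end Summit.BirchSwinnertonDyer.Rank1Residual.Additive.LocPKummer

end
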